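import Summits.QuantumFields.YangMills.Theorems.BalabanUVNodesN11SpaceTruncationFibre

/-!
# DAG node N11 — door (d4) AT THE RECORD ON THE ITERATED AVERAGING FIBRE: the two no-expansion 𝐓-step faces with def-R's background proviso read on the CHARGED
# ITERATED FIBRE `{slot_k(s₀) ≠ 0 ∧ χ_k ≠ 0 ∧ lower scales regular ∧ trivial off the V-bonds ∧ avg(𝐖_j) = 𝐖_{j+1}}` only (conclusions VERBATIM p594941)

HEADER — WORK-UNIT METADATA.  Cell `pub-ymgap`, YM-PLAN Track A (HUMAN RULING D-0062), seat `pub-ymgap-dag-n11-d` (g13; R134 fan-out seat N11 [B14], strategy s2),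
route `BalabanUVNodes`, item K1⁷ `StabilityBAtRecordR13SepCoPH` = stmt-QuantumFields-20542 (helper, `--kind proof --supports 20542 --as helper`, count-neutral).
[III] = [Balaban1988Convergent], [LF-I] = [Balaban1989LargeFieldI].  Over p594941 `…N11SpaceTruncationCharged` (whose §2 this file re-keys, proofs verbatim but for the
transport lemma) and g13's `…N11SpaceTruncationFibre` (`hasSect2FormAtZS_spaceTrunc(R)_of_charged_fibre`).

WHY THIS FILE.  See `…N11SpaceTruncationFibre`: the background proviso of the no-expansion 𝐓-step is needed only where 11a's `𝐓_k(s₀)` reads its operand for a.e. `V_k` —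
the CHARGED ITERATED FIBRE.  On that fibre the junction's (7)-data half is a theorem (`…N11Data7OnFibre`), so the separated-indices edition (sequel
`…N11ChargedSepJunctionFibre`) is keyed on the record row `bg` + the junction's TOP clause alone — one displayed row (`h7`) FEWER than p598649.

WHAT THIS FILE PROVES (0 `sorry`, 0 `def`).  ★★★ `exists_local_witness_clause_succ_of_sLaw₁₃CoPH_of_bgReadChargedFibre` and ★★★★
`exists_local_witness_clause_succ_of_hasSect2FormAtZS_of_borelB_of_bgReadChargedFibre` — p594941's two record faces, conclusions VERBATIM, the support set of `hbg` SHRUNK by the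
two fibre conjuncts.

HONEST FRAMING.  Helper lane of K1⁷; bookkeeping over tree theorems; nothing of Bałaban's is asserted.  N11 NOT discharged; K1⁷ NOT closed; counts unmoved (typed 28∕28 ·
discharged 5∕27).  One finite four-torus programme at fixed `ε = L^{−K}` — NOT ℝ⁴, NOT OS, NOT a mass gap, NOT Clay.  No `sorry`, `axiom`, `def`, `instance`, `notation`.
Sources (SHAPE only): [III] Theorem p.245, (2.7) p.255, (2.10) p.256, (2.18) p.257, (2.20)–(2.28) pp.258–259, (2.31) p.260, (2.41)–(2.42) p.261, Thm 1 p.262, (3.24)–(3.25) p.270;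
[LF-I] (0.2)–(0.3) p.176.
-/

noncomputable section

open MeasureTheory
open scoped BigOperators ENNReal NNReal Matrix.Norms.L2Operator

universe u

namespace Summit.QuantumFields.YangMills.Theorems.BalabanUVNodesN11SpaceTruncationChargedFibre

open Literature.MathematicalPhysics.QuantumFieldTheory.Balaban1983to89 T4Continuum T4NestedCovariance Node00 Node00.Tk DagBinding
open B15DeterminingSets B8Eq17ClassAkV1 Step B14.Eq227LocalizedTerms B14.Eq225Concrete B10Eq42TorusConstraint
open BalabanUVNodesN11FluctTruncationDefs (IsFluctLocal truncTermValues isFluctLocal_truncTermValues lawsRT_truncTermValues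
  action23_sect2ActionDataOfRecord_congr_fluct_of_isFluctLocal)
open BalabanUVNodesN11OpenLocusTruncationDefs BalabanUVNodesN11SpaceTruncationDefs BalabanUVNodesN11SpaceTruncationBorelBDefs BalabanUVNodesN11TkReadingSupport
open BalabanUVNodesN11FluctTruncation (sLaw₁₃CoPH_iff_exists_local hasSect2FormAtZS_truncTermValues)
open BalabanUVNodesN11NoExpansionOldBranchGraph (clause_succ_CoPH_of_Omega_empty_of_pinChi_of_oldBranch_of_clause_of_graph)
open BalabanUVNodesN11OldBranchIntegrableOfDominated (integrable_oldBranch_of_dominated)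
open BalabanUVNodesN11OperandRowsOfTermRows (measurable_sect2Operand_of_termRows exists_bound_sect2Operand_of_termBounds)
open BalabanUVNodesN11BackgroundCoPMeasurable (measurable_UbgOfRecord₁₃CoP)
open BalabanUVNodesN11SpaceTruncationFibre (hasSect2FormAtZS_spaceTrunc_of_charged_fibre hasSect2FormAtZS_spaceTruncR_of_charged_fibre)

/-! ## §1  AT THE RECORD: the two no-expansion 𝐓-step faces with the background proviso over the CHARGED ITERATED FIBRE -/

section Record

variable {F : T4Family} {N : ℕ} [NeZero N]

variable (θ : Stage13HParams F N) (p : B12.RunParams)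

/-- **★★★ p594941's ★★★ WITH THE BACKGROUND PROVISO READ ON THE CHARGED ITERATED FIBRE ONLY.**  As `…SpaceTruncationCharged.exists_local_witness_clause_succ_of_sLaw₁₃CoPH_of_bgReadCharged`,
conclusion VERBATIM, with def-R's `BgProvisoΛ` at the Co-class background asked over the CHARGED ITERATED FIBRE `{Wc | slot_k(s₀) ≠ 0 ∧ χ_k(s₀)(Wc k) ≠ 0 ∧
scales j < k regular at cR·ε_j on Γr s₀ j (Ω^c_{j+1}) ∧ Wc j ≡ 1 off bondsIn j (Ω_{j+1})ᶜ ∧ (avOfRecord j).avg (Wc j) = Wc (j+1) on bondsIn (j+1) (Ω_{j+1})ᶜ}` — the set on which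
11a's `𝐓_k(s₀)` reads its operand for a.e. `V_k` (`…TkIteratedFibreReadingSlot`).
[cite: Balaban1988Convergent, Theorem p.245, Thm 1 p.262, (2.7) p.255, (2.10) p.256, (2.18) p.257, (2.20)–(2.28) pp.258–259, (2.31) p.260, (2.41)–(2.42) p.261, (3.24)–(3.25) p.270; Balaban1989LargeFieldI, (0.2)–(0.3) p.176] -/
theorem exists_local_witness_clause_succ_of_sLaw₁₃CoPH_of_bgReadChargedFibre (h : θ.Provisos₁₃CoPH F N) (hU : θ.ZhUnity F N) (hθ : θ.Admissible F N)
    (hpos : θ.s2.Pos) {k : ℕ} (hk : k < p.K) (hM : 1 ≤ θ.τ9.M) (hw : Step.InInterval θ.γ k (gOfRecord₁₃ F N θ.toStage13Params p))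
    (cR : ℝ) (Γr : SeqOfRecord F θ.ν θ.τ9.M (gOfRecord₁₃ F N θ.toStage13Params p) p.K k → ℕ → Set (Site (F.P p.K) 0) → Set (Site (F.P p.K) 0))
    (hreg : ∀ s₀, (θ.zhAt p s₀).RegOn F N (FluctV N) θ.ν cR p (gOfRecord₁₃ F N θ.toStage13Params p) (Γr s₀))
    (hbg : BgProvisoΛ F N p.K (settingOfRecord₁₃ F N θ.toStage13Params p) (θ.Rz p.K) θ.τ9.M k
      (fun s₀ => {Wc | slotsOfRecord F N θ.ν θ.τ9 (EOfRecord₁₃ F N θ.toStage13Params) (wOfRecord₉ F N θ.toStage9Params) θ.ppSel p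
          (gOfRecord₁₃ F N θ.toStage13Params p) k s₀ ≠ 0 ∧
        chiSeqOfRecord F N θ.ν θ.τ9.M (gOfRecord₁₃ F N θ.toStage13Params p) p.K k s₀ (Wc k) ≠ 0 ∧
        (∀ j, j < k → PlaqSmallOn (plaqsOf (pts j (Γr s₀ j (s₀.Ω (j + 1))ᶜ))) (cR * epsOfRecord θ.ν (gOfRecord₁₃ F N θ.toStage13Params p) j) (Wc j)) ∧
        (∀ j, j < k → ∀ b : PBond (F.P p.K) j, b ∉ bondsIn j (s₀.Ω (j + 1))ᶜ → Wc j b = 1) ∧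
        (∀ j, j < k → ∀ b : PBond (F.P p.K) (j + 1), b ∈ bondsIn (j + 1) (s₀.Ω (j + 1))ᶜ → (avOfRecord F N p.K j).avg (Wc j) b = Wc (j + 1) b)})
      (UbgOfRecord₁₃CoP F N θ.toStage13Params p k))
    (hS : SLaw₁₃CoPH F N θ p k) :
    ∃ (t : SeqOfRecord F θ.ν θ.τ9.M (gOfRecord₁₃ F N θ.toStage13Params p) p.K k → Sect2.TermValues (F.P p.K) (MatA N) (FluctV N) θ.τ9.M)
      (Ek : SeqOfRecord F θ.ν θ.τ9.M (gOfRecord₁₃ F N θ.toStage13Params p) p.K k → ℝ),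
      HasSect2FormAtZS F N (FluctV N) p.K (settingOfRecord₁₃ F N θ.toStage13Params p) k (θ.rzAt p) (WtOfRecord₁₃H F N θ p)
          (UbgOfRecord₁₃CoP F N θ.toStage13Params p k)
          (fun s₀ t₀ => Sect2.LawsRT (sect2TowerOfRecord F N (FluctV N) p.K (settingOfRecord₁₃ F N θ.toStage13Params p) (θ.rzAt p s₀) s₀ t₀)
            (settingOfRecord₁₃ F N θ.toStage13Params p).lf k)
          (slotsOfRecord F N θ.ν θ.τ9 (EOfRecord₁₃ F N θ.toStage13Params) (wOfRecord₉ F N θ.toStage9Params) θ.ppSel p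
            (gOfRecord₁₃ F N θ.toStage13Params p) k) t Ek ∧
      (∀ s₀, IsFluctLocal k (t s₀)) ∧
      ∀ (s : SeqOfRecord F θ.ν θ.τ9.M (gOfRecord₁₃ F N θ.toStage13Params p) p.K (k + 1)), s.Ω (k + 1) = ∅ →
        -- (P) prefix agreement below `k`
        (∀ j, j < k → (θ.zhAt p s).ζ0 j = (θ.zhAt p s.init).ζ0 j ∧ (θ.zhAt p s).quad j = (θ.zhAt p s.init).quad j) →
        -- (V) the generation-`k` pin with the old front factor
        (∀ (V' : GaugeField (F.P p.K) (k + 1) (SU N)) (U₀ : GaugeField (F.P p.K) k (SU N)),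
          (θ.zhAt p s).ζ0 k Set.univ (pairCfgAt (V := FluctV N) k V' U₀) =
            chiSeqOfRecord F N θ.ν θ.τ9.M (gOfRecord₁₃ F N θ.toStage13Params p) p.K k s.init U₀ *
              wOfRecord₉ F N θ.toStage9Params p (gOfRecord₁₃ F N θ.toStage13Params p) k s U₀ ((avOfRecord F N p.K k).avg U₀)) →
        -- `quad_k(∅) = 0` on the two-scale configurations
        (∀ (V' : GaugeField (F.P p.K) (k + 1) (SU N)) (U₀ : GaugeField (F.P p.K) k (SU N)), (θ.zhAt p s).quad k ∅ (pairCfgAt (V := FluctV N) k V' U₀) = 0) →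
        -- `k`-locality of `quad_j(Λ_{j+1})`, `j < k`
        (∀ j, j < k → ∀ ω ω' : MultiCfg (F.P p.K) (SU N) (FluctV N), (∀ i, i ≤ k → ω i = ω' i) →
          (θ.zhAt p s).quad j (s.init.Λ (j + 1)) ω = (θ.zhAt p s).quad j (s.init.Λ (j + 1)) ω') →
        -- measurability of the residual serving `s′`
        (∀ j (Y : Set (Site (F.P p.K) 0)), Measurable ((θ.zhAt p s).ζ0 j Y)) →
        (∀ j (Λ' : Set (Site (F.P p.K) 0)), Measurable ((θ.zhAt p s).quad j Λ')) →
        -- per old branch: A-fibre domination (K0b)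
        (∀ S ∈ admSOfRecord F θ.ν θ.τ9.M (gOfRecord₁₃ F N θ.toStage13Params p) p.K k s.init, ∀ j : ℕ,
          ∃ ŵ : (↥(Set.toFinite (B10Eq42TorusConstraint.bondsIn j ((s.init.Λ (j + 1))ᶜ ∩ s.init.Ω (j + 1)))).toFinset → FluctV N) → ℝ≥0∞, Measurable ŵ ∧
            (∫⁻ a, ŵ a ∂(Measure.pi fun _ : ↥(Set.toFinite (B10Eq42TorusConstraint.bondsIn j ((s.init.Λ (j + 1))ᶜ ∩ s.init.Ω (j + 1)))).toFinset => (volume : Measure (FluctV N)))) ≠ ⊤ ∧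
            ∀ ω, ENNReal.ofReal ((WtOfRecord₁₃H F N θ p s).w j (s.init.Λ (j + 1)) ((s.init.Λ (j + 1))ᶜ ∩ s.init.Ω (j + 1)) (S (j + 1)) ω) ≤
              ŵ (fun b : ↥(Set.toFinite (B10Eq42TorusConstraint.bondsIn j ((s.init.Λ (j + 1))ᶜ ∩ s.init.Ω (j + 1)))).toFinset => (ω j).2 b)) →
        -- def-T: the 𝐁-terms of the witness at the parent history, READ AT THE EMBEDDED BACKGROUND, are JOINTLY measurable in `(U, A)` (LOCATED residue)
        (∀ (S' : ℕ → Set (Site (F.P p.K) 0)) (j : ℕ) (X : (Sect2.domSys (F.P p.K) θ.τ9.M j).Dom),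
          Measurable (fun q : GaugeField (F.P p.K) 0 (SU N) × MSFluct (F.P p.K) (FluctV N) =>
            ((t s.init).B j X (Sect2.ofBackgroundC (settingOfRecord₁₃ F N θ.toStage13Params p).ι q.1) (S', q.2)).re)) →
        (slotsTOfRecord F N θ.ν θ.τ9 (EOfRecord₁₃ F N θ.toStage13Params) (wOfRecord₉ F N θ.toStage9Params) θ.ppSel p
            (gOfRecord₁₃ F N θ.toStage13Params p) (k + 1) s = 0 ∨
          ∀ᵐ V' ∂fieldMeasure (F.P p.K) (k + 1) (SU N),
            chiSeqOfRecord F N θ.ν θ.τ9.M (gOfRecord₁₃ F N θ.toStage13Params p) p.K (k + 1) s V' ≠ 0 →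
              slotsTOfRecord F N θ.ν θ.τ9 (EOfRecord₁₃ F N θ.toStage13Params) (wOfRecord₉ F N θ.toStage9Params) θ.ppSel p
                  (gOfRecord₁₃ F N θ.toStage13Params p) (k + 1) s V' =
                sect2Slot F N (FluctV N) p.K (settingOfRecord₁₃ F N θ.toStage13Params p) (θ.rzAt p s) (WtOfRecord₁₃H F N θ p s) s
                  (t s.init) (Ek s.init) (UbgOfRecord₁₃CoP F N θ.toStage13Params p (k + 1) s) V') := by
  obtain ⟨t, Ek, hform, hloc⟩ := (sLaw₁₃CoPH_iff_exists_local θ p k).1 hS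
  -- the run's window: couplings `g_{j−1} ∈ [0, γ]`, positive radii, the vacuum in every `U^c_j(X)`
  have hg : ∀ j, 1 ≤ j → j ≤ k → 0 ≤ (settingOfRecord₁₃ F N θ.toStage13Params p).flow.g (j - 1) ∧
      (settingOfRecord₁₃ F N θ.toStage13Params p).flow.g (j - 1) ≤ (settingOfRecord₁₃ F N θ.toStage13Params p).lf.γ :=
    fun j _ hj => ⟨(hw (j - 1) (by omega)).1.le, (hw (j - 1) (by omega)).2⟩
  have h1 : ∀ (s₀ : SeqOfRecord F θ.ν θ.τ9.M (gOfRecord₁₃ F N θ.toStage13Params p) p.K k) (j : ℕ), 1 ≤ j → j ≤ k →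
      ∀ X : (Sect2.domSys (F.P p.K) θ.τ9.M j).Dom,
      Sect2.ofBackgroundC (settingOfRecord₁₃ F N θ.toStage13Params p).ι (1 : GaugeField (F.P p.K) 0 (SU N)) ∈
        Sect2.spaceI (settingOfRecord₁₃ F N θ.toStage13Params p) (θ.rzAt p s₀) θ.τ9.M j (Sect2.domSites (F.P p.K) θ.τ9.M j X)
          ((settingOfRecord₁₃ F N θ.toStage13Params p).lf.alpha0 ((settingOfRecord₁₃ F N θ.toStage13Params p).flow.g j))
          ((settingOfRecord₁₃ F N θ.toStage13Params p).lf.alpha1 ((settingOfRecord₁₃ F N θ.toStage13Params p).flow.g j)) :=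
    fun s₀ j _ hj X => Sect2.one_mem_spaceI _ (settingOfRecord₁₃_pos F N θ.toStage13Params hpos p).cB_pos (h.rzAtLaws p s₀) θ.τ9.M j _
      (alphaPos₁₃_of_inInterval hθ hw hj).1 (alphaPos₁₃_of_inInterval hθ hw hj).2
  have hformT := hasSect2FormAtZS_spaceTrunc_of_charged_fibre (settingOfRecord₁₃ F N θ.toStage13Params p) (le_refl k) (θ.rzAt p) (WtOfRecord₁₃H F N θ p)
    (UbgOfRecord₁₃CoP F N θ.toStage13Params p k) _
    (fun s₀ j U₀ => PlaqSmallOn (plaqsOf (pts j (Γr s₀ j (s₀.Ω (j + 1))ᶜ))) (cR * epsOfRecord θ.ν (gOfRecord₁₃ F N θ.toStage13Params p) j) U₀)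
    (fun s₀ j _ ω hz => plaqSmallOn_readOn_of_zetaP_ne_zero (hreg s₀) s₀.Ω j hz) hg h1
    (fun s₀ hs Wc hχ hR hoff hfb j h1j hjk X => hbg s₀ Wc ⟨hs, hχ, hR, hoff, hfb⟩ j h1j hjk X) hform
  refine ⟨fun s₀ => spaceTrunc (settingOfRecord₁₃ F N θ.toStage13Params p) k (t s₀), Ek, hformT,
    fun s₀ => isFluctLocal_spaceTrunc (hloc s₀) _ k, fun s hΩ hpre hZ hq hqloc hζm hqm hW hB => ?_⟩
  refine clause_succ_CoPH_of_Omega_empty_of_pinChi_of_oldBranch_of_clause_of_graph θ p h hk hM s hΩ hqloc hpre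
    (spaceTrunc (settingOfRecord₁₃ F N θ.toStage13Params p) k (t s.init)) (Ek s.init)
    (fun S a a' Uf ha => action23_sect2ActionDataOfRecord_congr_fluct_of_isFluctLocal p.K _ _ s.init (isFluctLocal_spaceTrunc (hloc s.init) _ k)
      (Ek s.init) S a a' ha Uf)
    (hformT.2 s.init).2 hZ hq fun S hSm => ?_
  choose ŵ hŵm hŵfin hdom using hW S hSm
  haveI : BorelSpace (GaugeField (F.P p.K) 0 (SU N)) := inferInstanceAs (BorelSpace (PBond (F.P p.K) 0 → SU N))
  have hcont : Continuous fun U : GaugeField (F.P p.K) 0 (SU N) => Sect2.ofBackgroundC (settingOfRecord₁₃ F N θ.toStage13Params p).ι U :=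
    continuous_ofBackgroundC_ιSU
  have hΦm := measurable_sect2Operand_of_termRows p.K (settingOfRecord₁₃ F N θ.toStage13Params p) (θ.rzAt p s.init) s.init
    (spaceTrunc (settingOfRecord₁₃ F N θ.toStage13Params p) k (t s.init)) (Ek s.init) (measurable_UbgOfRecord₁₃CoP F N θ.toStage13Params p k s.init) S
    (fun j X z g' => measurable_re_spaceTrunc_E_comp _ k (t s.init) hcont j X z g')
    (fun j X => measurable_re_spaceTrunc_R_comp _ k (t s.init) hcont j X) (hB S)
  obtain ⟨CE, hCE⟩ := exists_bound_spaceTrunc_E (settingOfRecord₁₃ F N θ.toStage13Params p) k (t s.init)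
  obtain ⟨CR, hCR⟩ := exists_bound_spaceTrunc_R (settingOfRecord₁₃ F N θ.toStage13Params p) k (t s.init)
  obtain ⟨CB, hCB⟩ := exists_bound_spaceTrunc_B (settingOfRecord₁₃ F N θ.toStage13Params p) k (t s.init)
  obtain ⟨CΦ, hΦle⟩ := exists_bound_sect2Operand_of_termBounds p.K (settingOfRecord₁₃ F N θ.toStage13Params p) (θ.rzAt p s.init) s.init
    (spaceTrunc (settingOfRecord₁₃ F N θ.toStage13Params p) k (t s.init)) (Ek s.init) (UbgOfRecord₁₃CoP F N θ.toStage13Params p k s.init)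
    ⟨CE, fun j X z g' U => hCE j X z g' _⟩ ⟨CR, fun j X U => hCR j X _⟩ ⟨CB, fun j X U a => hCB j X _ a⟩
  exact integrable_oldBranch_of_dominated θ p h.zhLaws hU s S hζm hqm ŵ hŵm
    (fun j => (∫⁻ a, ŵ j a ∂(Measure.pi fun _ : ↥(Set.toFinite (B10Eq42TorusConstraint.bondsIn j ((s.init.Λ (j + 1))ᶜ ∩ s.init.Ω (j + 1)))).toFinset => (volume : Measure (FluctV N)))).toNNReal)
    (fun j => le_of_eq (ENNReal.coe_toNNReal (hŵfin j)).symm) hdom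
    (Φ := sect2Operand F N (FluctV N) p.K (settingOfRecord₁₃ F N θ.toStage13Params p) (θ.rzAt p s.init) s.init
      (spaceTrunc (settingOfRecord₁₃ F N θ.toStage13Params p) k (t s.init)) (Ek s.init) (UbgOfRecord₁₃CoP F N θ.toStage13Params p k s.init))
    hΦm (fun a U => (sect2Operand_pos p.K _ _ s.init _ (Ek s.init) _ a U).le) CΦ hΦle

/-- **★★★★ p594941's WITNESS-FIRST FACE WITH THE BACKGROUND PROVISO READ ON THE CHARGED ITERATED FIBRE ONLY.**  As
`…SpaceTruncationCharged.exists_local_witness_clause_succ_of_hasSect2FormAtZS_of_borelB_of_bgReadCharged` (a NAMED §2 witness `(t₀, E₀)` whose 𝐁-terms are Borel along the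
embedding, `hBt`; NO row on the witness), conclusion VERBATIM, with def-R's `BgProvisoΛ` asked over the CHARGED ITERATED FIBRE only.
[cite: Balaban1988Convergent, Theorem p.245, Thm 1 p.262, (2.7) p.255, (2.10) p.256, (2.18) p.257, (2.20)–(2.28) pp.258–259, (2.31) p.260, (2.41)–(2.42) p.261, (3.24)–(3.25) p.270; Balaban1989LargeFieldI, (0.2)–(0.3) p.176; Balaban1987RG1, Thm 3 p.264] -/
theorem exists_local_witness_clause_succ_of_hasSect2FormAtZS_of_borelB_of_bgReadChargedFibre (h : θ.Provisos₁₃CoPH F N) (hU : θ.ZhUnity F N)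
    (hθ : θ.Admissible F N) (hpos : θ.s2.Pos) {k : ℕ} (hk : k < p.K) (hM : 1 ≤ θ.τ9.M) (hw : Step.InInterval θ.γ k (gOfRecord₁₃ F N θ.toStage13Params p))
    (cR : ℝ) (Γr : SeqOfRecord F θ.ν θ.τ9.M (gOfRecord₁₃ F N θ.toStage13Params p) p.K k → ℕ → Set (Site (F.P p.K) 0) → Set (Site (F.P p.K) 0))
    (hreg : ∀ s₀, (θ.zhAt p s₀).RegOn F N (FluctV N) θ.ν cR p (gOfRecord₁₃ F N θ.toStage13Params p) (Γr s₀))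
    (hbg : BgProvisoΛ F N p.K (settingOfRecord₁₃ F N θ.toStage13Params p) (θ.Rz p.K) θ.τ9.M k
      (fun s₀ => {Wc | slotsOfRecord F N θ.ν θ.τ9 (EOfRecord₁₃ F N θ.toStage13Params) (wOfRecord₉ F N θ.toStage9Params) θ.ppSel p
          (gOfRecord₁₃ F N θ.toStage13Params p) k s₀ ≠ 0 ∧
        chiSeqOfRecord F N θ.ν θ.τ9.M (gOfRecord₁₃ F N θ.toStage13Params p) p.K k s₀ (Wc k) ≠ 0 ∧
        (∀ j, j < k → PlaqSmallOn (plaqsOf (pts j (Γr s₀ j (s₀.Ω (j + 1))ᶜ))) (cR * epsOfRecord θ.ν (gOfRecord₁₃ F N θ.toStage13Params p) j) (Wc j)) ∧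
        (∀ j, j < k → ∀ b : PBond (F.P p.K) j, b ∉ bondsIn j (s₀.Ω (j + 1))ᶜ → Wc j b = 1) ∧
        (∀ j, j < k → ∀ b : PBond (F.P p.K) (j + 1), b ∈ bondsIn (j + 1) (s₀.Ω (j + 1))ᶜ → (avOfRecord F N p.K j).avg (Wc j) b = Wc (j + 1) b)})
      (UbgOfRecord₁₃CoP F N θ.toStage13Params p k))
    (t₀ : SeqOfRecord F θ.ν θ.τ9.M (gOfRecord₁₃ F N θ.toStage13Params p) p.K k → Sect2.TermValues (F.P p.K) (MatA N) (FluctV N) θ.τ9.M)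
    (E₀ : SeqOfRecord F θ.ν θ.τ9.M (gOfRecord₁₃ F N θ.toStage13Params p) p.K k → ℝ)
    (hform₀ : HasSect2FormAtZS F N (FluctV N) p.K (settingOfRecord₁₃ F N θ.toStage13Params p) k (θ.rzAt p) (WtOfRecord₁₃H F N θ p)
      (UbgOfRecord₁₃CoP F N θ.toStage13Params p k)
      (fun s₀ t' => Sect2.LawsRT (sect2TowerOfRecord F N (FluctV N) p.K (settingOfRecord₁₃ F N θ.toStage13Params p) (θ.rzAt p s₀) s₀ t')
        (settingOfRecord₁₃ F N θ.toStage13Params p).lf k)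
      (slotsOfRecord F N θ.ν θ.τ9 (EOfRecord₁₃ F N θ.toStage13Params) (wOfRecord₉ F N θ.toStage9Params) θ.ppSel p (gOfRecord₁₃ F N θ.toStage13Params p) k) t₀ E₀)
    (hBt : ∀ s₀ (S' : ℕ → Set (Site (F.P p.K) 0)) (j : ℕ) (X : (Sect2.domSys (F.P p.K) θ.τ9.M j).Dom),
      Measurable (fun q : GaugeField (F.P p.K) 0 (SU N) × MSFluct (F.P p.K) (FluctV N) =>
        (t₀ s₀).B j X (Sect2.ofBackgroundC (settingOfRecord₁₃ F N θ.toStage13Params p).ι q.1) (S', q.2))) :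
    ∃ (t : SeqOfRecord F θ.ν θ.τ9.M (gOfRecord₁₃ F N θ.toStage13Params p) p.K k → Sect2.TermValues (F.P p.K) (MatA N) (FluctV N) θ.τ9.M)
      (Ek : SeqOfRecord F θ.ν θ.τ9.M (gOfRecord₁₃ F N θ.toStage13Params p) p.K k → ℝ),
      HasSect2FormAtZS F N (FluctV N) p.K (settingOfRecord₁₃ F N θ.toStage13Params p) k (θ.rzAt p) (WtOfRecord₁₃H F N θ p)
          (UbgOfRecord₁₃CoP F N θ.toStage13Params p k)
          (fun s₀ t₀ => Sect2.LawsRT (sect2TowerOfRecord F N (FluctV N) p.K (settingOfRecord₁₃ F N θ.toStage13Params p) (θ.rzAt p s₀) s₀ t₀)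
            (settingOfRecord₁₃ F N θ.toStage13Params p).lf k)
          (slotsOfRecord F N θ.ν θ.τ9 (EOfRecord₁₃ F N θ.toStage13Params) (wOfRecord₉ F N θ.toStage9Params) θ.ppSel p
            (gOfRecord₁₃ F N θ.toStage13Params p) k) t Ek ∧
      (∀ s₀, IsFluctLocal k (t s₀)) ∧
      ∀ (s : SeqOfRecord F θ.ν θ.τ9.M (gOfRecord₁₃ F N θ.toStage13Params p) p.K (k + 1)), s.Ω (k + 1) = ∅ →
        -- (P) prefix agreement below `k`
        (∀ j, j < k → (θ.zhAt p s).ζ0 j = (θ.zhAt p s.init).ζ0 j ∧ (θ.zhAt p s).quad j = (θ.zhAt p s.init).quad j) →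
        -- (V) the generation-`k` pin with the old front factor
        (∀ (V' : GaugeField (F.P p.K) (k + 1) (SU N)) (U₀ : GaugeField (F.P p.K) k (SU N)),
          (θ.zhAt p s).ζ0 k Set.univ (pairCfgAt (V := FluctV N) k V' U₀) =
            chiSeqOfRecord F N θ.ν θ.τ9.M (gOfRecord₁₃ F N θ.toStage13Params p) p.K k s.init U₀ *
              wOfRecord₉ F N θ.toStage9Params p (gOfRecord₁₃ F N θ.toStage13Params p) k s U₀ ((avOfRecord F N p.K k).avg U₀)) →
        -- `quad_k(∅) = 0` on the two-scale configurations
        (∀ (V' : GaugeField (F.P p.K) (k + 1) (SU N)) (U₀ : GaugeField (F.P p.K) k (SU N)), (θ.zhAt p s).quad k ∅ (pairCfgAt (V := FluctV N) k V' U₀) = 0) →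
        -- `k`-locality of `quad_j(Λ_{j+1})`, `j < k`
        (∀ j, j < k → ∀ ω ω' : MultiCfg (F.P p.K) (SU N) (FluctV N), (∀ i, i ≤ k → ω i = ω' i) →
          (θ.zhAt p s).quad j (s.init.Λ (j + 1)) ω = (θ.zhAt p s).quad j (s.init.Λ (j + 1)) ω') →
        -- measurability of the residual serving `s′`
        (∀ j (Y : Set (Site (F.P p.K) 0)), Measurable ((θ.zhAt p s).ζ0 j Y)) →
        (∀ j (Λ' : Set (Site (F.P p.K) 0)), Measurable ((θ.zhAt p s).quad j Λ')) →
        -- per old branch: A-fibre domination (K0b)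
        (∀ S ∈ admSOfRecord F θ.ν θ.τ9.M (gOfRecord₁₃ F N θ.toStage13Params p) p.K k s.init, ∀ j : ℕ,
          ∃ ŵ : (↥(Set.toFinite (B10Eq42TorusConstraint.bondsIn j ((s.init.Λ (j + 1))ᶜ ∩ s.init.Ω (j + 1)))).toFinset → FluctV N) → ℝ≥0∞, Measurable ŵ ∧
            (∫⁻ a, ŵ a ∂(Measure.pi fun _ : ↥(Set.toFinite (B10Eq42TorusConstraint.bondsIn j ((s.init.Λ (j + 1))ᶜ ∩ s.init.Ω (j + 1)))).toFinset => (volume : Measure (FluctV N)))) ≠ ⊤ ∧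
            ∀ ω, ENNReal.ofReal ((WtOfRecord₁₃H F N θ p s).w j (s.init.Λ (j + 1)) ((s.init.Λ (j + 1))ᶜ ∩ s.init.Ω (j + 1)) (S (j + 1)) ω) ≤
              ŵ (fun b : ↥(Set.toFinite (B10Eq42TorusConstraint.bondsIn j ((s.init.Λ (j + 1))ᶜ ∩ s.init.Ω (j + 1)))).toFinset => (ω j).2 b)) →
        (slotsTOfRecord F N θ.ν θ.τ9 (EOfRecord₁₃ F N θ.toStage13Params) (wOfRecord₉ F N θ.toStage9Params) θ.ppSel p
            (gOfRecord₁₃ F N θ.toStage13Params p) (k + 1) s = 0 ∨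
          ∀ᵐ V' ∂fieldMeasure (F.P p.K) (k + 1) (SU N),
            chiSeqOfRecord F N θ.ν θ.τ9.M (gOfRecord₁₃ F N θ.toStage13Params p) p.K (k + 1) s V' ≠ 0 →
              slotsTOfRecord F N θ.ν θ.τ9 (EOfRecord₁₃ F N θ.toStage13Params) (wOfRecord₉ F N θ.toStage9Params) θ.ppSel p
                  (gOfRecord₁₃ F N θ.toStage13Params p) (k + 1) s V' =
                sect2Slot F N (FluctV N) p.K (settingOfRecord₁₃ F N θ.toStage13Params p) (θ.rzAt p s) (WtOfRecord₁₃H F N θ p s) s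
                  (t s.init) (Ek s.init) (UbgOfRecord₁₃CoP F N θ.toStage13Params p (k + 1) s) V') := by
  -- g10's fluctuation truncation at level `k`, then the space truncation with retracted boundary terms, the background read on the charged iterated fibre only
  have hform₁ := hasSect2FormAtZS_truncTermValues (settingOfRecord₁₃ F N θ.toStage13Params p) (Nat.le_succ k) (θ.rzAt p) (WtOfRecord₁₃H F N θ p)
    (UbgOfRecord₁₃CoP F N θ.toStage13Params p k) _ _
    (fun s₀ t' ht' => lawsRT_truncTermValues (settingOfRecord₁₃ F N θ.toStage13Params p) (θ.rzAt p s₀) s₀.Ω t' _ k k ht') hform₀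
  have hg : ∀ j, 1 ≤ j → j ≤ k → 0 ≤ (settingOfRecord₁₃ F N θ.toStage13Params p).flow.g (j - 1) ∧
      (settingOfRecord₁₃ F N θ.toStage13Params p).flow.g (j - 1) ≤ (settingOfRecord₁₃ F N θ.toStage13Params p).lf.γ :=
    fun j _ hj => ⟨(hw (j - 1) (by omega)).1.le, (hw (j - 1) (by omega)).2⟩
  have h1 : ∀ (s₀ : SeqOfRecord F θ.ν θ.τ9.M (gOfRecord₁₃ F N θ.toStage13Params p) p.K k) (j : ℕ), 1 ≤ j → j ≤ k →
      ∀ X : (Sect2.domSys (F.P p.K) θ.τ9.M j).Dom,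
      Sect2.ofBackgroundC (settingOfRecord₁₃ F N θ.toStage13Params p).ι (1 : GaugeField (F.P p.K) 0 (SU N)) ∈
        Sect2.spaceI (settingOfRecord₁₃ F N θ.toStage13Params p) (θ.rzAt p s₀) θ.τ9.M j (Sect2.domSites (F.P p.K) θ.τ9.M j X)
          ((settingOfRecord₁₃ F N θ.toStage13Params p).lf.alpha0 ((settingOfRecord₁₃ F N θ.toStage13Params p).flow.g j))
          ((settingOfRecord₁₃ F N θ.toStage13Params p).lf.alpha1 ((settingOfRecord₁₃ F N θ.toStage13Params p).flow.g j)) :=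
    fun s₀ j _ hj X => Sect2.one_mem_spaceI _ (settingOfRecord₁₃_pos F N θ.toStage13Params hpos p).cB_pos (h.rzAtLaws p s₀) θ.τ9.M j _
      (alphaPos₁₃_of_inInterval hθ hw hj).1 (alphaPos₁₃_of_inInterval hθ hw hj).2
  have hformT := hasSect2FormAtZS_spaceTruncR_of_charged_fibre (settingOfRecord₁₃ F N θ.toStage13Params p) (le_refl k) (θ.rzAt p) (WtOfRecord₁₃H F N θ p)
    (UbgOfRecord₁₃CoP F N θ.toStage13Params p k) _
    (fun s₀ j U₀ => PlaqSmallOn (plaqsOf (pts j (Γr s₀ j (s₀.Ω (j + 1))ᶜ))) (cR * epsOfRecord θ.ν (gOfRecord₁₃ F N θ.toStage13Params p) j) U₀)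
    (fun s₀ j _ ω hz => plaqSmallOn_readOn_of_zetaP_ne_zero (hreg s₀) s₀.Ω j hz) hg h1
    (fun s₀ hs Wc hχ hR hoff hfb j h1j hjk X => hbg s₀ Wc ⟨hs, hχ, hR, hoff, hfb⟩ j h1j hjk X) hform₁
  refine ⟨fun s₀ => spaceTruncR (settingOfRecord₁₃ F N θ.toStage13Params p) k (truncTermValues k (t₀ s₀)), E₀, hformT,
    fun s₀ => isFluctLocal_spaceTruncR (isFluctLocal_truncTermValues k (t₀ s₀)) _ k, fun s hΩ hpre hZ hq hqloc hζm hqm hW => ?_⟩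
  refine clause_succ_CoPH_of_Omega_empty_of_pinChi_of_oldBranch_of_clause_of_graph θ p h hk hM s hΩ hqloc hpre
    (spaceTruncR (settingOfRecord₁₃ F N θ.toStage13Params p) k (truncTermValues k (t₀ s.init))) (E₀ s.init)
    (fun S a a' Uf ha => action23_sect2ActionDataOfRecord_congr_fluct_of_isFluctLocal p.K _ _ s.init
      (isFluctLocal_spaceTruncR (isFluctLocal_truncTermValues k (t₀ s.init)) _ k) (E₀ s.init) S a a' ha Uf)
    (hformT.2 s.init).2 hZ hq fun S hSm => ?_
  choose ŵ hŵm hŵfin hdom using hW S hSm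
  haveI : BorelSpace (GaugeField (F.P p.K) 0 (SU N)) := inferInstanceAs (BorelSpace (PBond (F.P p.K) 0 → SU N))
  have hcont : Continuous fun U : GaugeField (F.P p.K) 0 (SU N) => Sect2.ofBackgroundC (settingOfRecord₁₃ F N θ.toStage13Params p).ι U :=
    continuous_ofBackgroundC_ιSU
  have hΦm := measurable_sect2Operand_of_termRows p.K (settingOfRecord₁₃ F N θ.toStage13Params p) (θ.rzAt p s.init) s.init
    (spaceTruncR (settingOfRecord₁₃ F N θ.toStage13Params p) k (truncTermValues k (t₀ s.init))) (E₀ s.init)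
    (measurable_UbgOfRecord₁₃CoP F N θ.toStage13Params p k s.init) S
    (fun j X z g' => measurable_re_spaceTrunc_E_comp _ k (truncTermValues k (t₀ s.init)) hcont j X z g')
    (fun j X => measurable_re_spaceTrunc_R_comp _ k (truncTermValues k (t₀ s.init)) hcont j X)
    (fun j X => measurable_re_spaceTruncR_B_comp_of_borel _ k (truncTermValues k (t₀ s.init)) j X (fl := fun a : MSFluct (F.P p.K) (FluctV N) => (S, a))
      (measurable_B_truncTermValues_of_borel (t₀ s.init) k j X S (hBt s.init S j X)))
  obtain ⟨CE, hCE⟩ := exists_bound_spaceTrunc_E (settingOfRecord₁₃ F N θ.toStage13Params p) k (truncTermValues k (t₀ s.init))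
  obtain ⟨CR, hCR⟩ := exists_bound_spaceTrunc_R (settingOfRecord₁₃ F N θ.toStage13Params p) k (truncTermValues k (t₀ s.init))
  obtain ⟨CB, hCB⟩ := exists_bound_spaceTruncR_B (settingOfRecord₁₃ F N θ.toStage13Params p) k (truncTermValues k (t₀ s.init))
  obtain ⟨CΦ, hΦle⟩ := exists_bound_sect2Operand_of_termBounds p.K (settingOfRecord₁₃ F N θ.toStage13Params p) (θ.rzAt p s.init) s.init
    (spaceTruncR (settingOfRecord₁₃ F N θ.toStage13Params p) k (truncTermValues k (t₀ s.init))) (E₀ s.init) (UbgOfRecord₁₃CoP F N θ.toStage13Params p k s.init)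
    ⟨CE, fun j X z g' U => hCE j X z g' _⟩ ⟨CR, fun j X U => hCR j X _⟩ ⟨CB, fun j X U a => hCB j X _ a⟩
  exact integrable_oldBranch_of_dominated θ p h.zhLaws hU s S hζm hqm ŵ hŵm
    (fun j => (∫⁻ a, ŵ j a ∂(Measure.pi fun _ : ↥(Set.toFinite (B10Eq42TorusConstraint.bondsIn j ((s.init.Λ (j + 1))ᶜ ∩ s.init.Ω (j + 1)))).toFinset => (volume : Measure (FluctV N)))).toNNReal)
    (fun j => le_of_eq (ENNReal.coe_toNNReal (hŵfin j)).symm) hdom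
    (Φ := sect2Operand F N (FluctV N) p.K (settingOfRecord₁₃ F N θ.toStage13Params p) (θ.rzAt p s.init) s.init
      (spaceTruncR (settingOfRecord₁₃ F N θ.toStage13Params p) k (truncTermValues k (t₀ s.init))) (E₀ s.init) (UbgOfRecord₁₃CoP F N θ.toStage13Params p k s.init))
    hΦm (fun a U => (sect2Operand_pos p.K _ _ s.init _ (E₀ s.init) _ a U).le) CΦ hΦle

end Record

end Summit.QuantumFields.YangMills.Theorems.BalabanUVNodesN11SpaceTruncationChargedFibre

end
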